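import Mathlib

/-!
# Crux `FeketeSOS.SublinearShadow` (stmt-ValiantsHypothesis-14990), line `Sketch`
# (window / DFT de-bordering), stub `stub_evalSupport`: digits stay on the support

For a two-variable polynomial `Y ∈ K[X][Π]` (outer variable `Π`, coefficients = "digits"
`Y.coeff n ∈ K[X]`) and a scalar `a : K`, the specialisation `Y(Π = a) = Y.eval (C a)` equals
`Σ_{n ∈ supp Y} (Y.coeff n) · C (a ^ n)`, so its `k`-th `X`-coefficient is
`Σ_n (Y.coeff n).coeff k · a ^ n` (`Polynomial.eval_eq_sum`, `Polynomial.finsetSum_coeff`,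
`Polynomial.coeff_mul_C`).  Hence if every digit is supported inside a finite set `S ⊆ ℕ`, so is
`Y.eval (C a)`.  In the composition of the line this gives `|supp Y_i(ζ^k, X)| ≤ |supp g_i|`.
-/

namespace Summit.ValiantsHypothesis.ValiantsHypothesis.Theorems.SublinearShadowSketch

open Polynomial Finset

-- `Summit.ValiantsHypothesis.ValiantsHypothesis.…` is the tree's mandated single-conjunct layout (Sub = Summit).
set_option linter.dupNamespace false

/-- Coefficients of a specialisation at a constant: the `k`-th `X`-coefficient of `Y.eval (C a)` is
`Σ_{n ∈ supp Y} (Y.coeff n).coeff k * a ^ n`. [folklore] -/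
theorem evs_coeff_eval_C (K : Type) [Field K] (Y : Polynomial (Polynomial K)) (a : K) (k : ℕ) :
    (Y.eval (C a)).coeff k = ∑ n ∈ Y.support, (Y.coeff n).coeff k * a ^ n := by
  rw [eval_eq_sum, sum_def, finsetSum_coeff]
  refine Finset.sum_congr rfl fun n _ => ?_
  rw [← C_pow, coeff_mul_C]

/-- If the `k`-th `X`-coefficient of every digit `Y.coeff n` vanishes, so does the `k`-th
`X`-coefficient of the specialisation `Y.eval (C a)`. [folklore] -/
theorem evs_coeff_eval_C_eq_zero (K : Type) [Field K] (Y : Polynomial (Polynomial K)) (a : K)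
    (k : ℕ) (hk : ∀ n, (Y.coeff n).coeff k = 0) : (Y.eval (C a)).coeff k = 0 := by
  rw [evs_coeff_eval_C]
  exact Finset.sum_eq_zero fun n _ => by rw [hk n, zero_mul]

/-- **Digits stay on the support.**  If every `Π`-digit `Y.coeff n ∈ K[X]` of `Y ∈ K[X][Π]` is supported
inside `S`, then so is the specialisation `Y(Π = a)`. [folklore] -/
theorem stub_evalSupport (K : Type) [Field K] (Y : Polynomial (Polynomial K)) (S : Finset ℕ) (a : K)
    (hY : ∀ n, (Y.coeff n).support ⊆ S) :
    (Y.eval (C a)).support ⊆ S := by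
  intro k hk
  by_contra hkS
  refine (mem_support_iff.mp hk) (evs_coeff_eval_C_eq_zero K Y a k fun n => ?_)
  exact notMem_support_iff.mp fun h => hkS (hY n h)

end Summit.ValiantsHypothesis.ValiantsHypothesis.Theorems.SublinearShadowSketch
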